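import Literature.MathematicalPhysics.QuantumFieldTheory.Balaban1983to89.B6SectCOperators
import Literature.MathematicalPhysics.QuantumFieldTheory.BalabanImbrieJaffe1984to88.BIJ85Eq461Proof

/-!
# `Balaban1983to89.B6SectCPositivity` — T. Bałaban, *Propagators and renormalization transformations for lattice gauge
# theories. II*, Commun. Math. Phys. **96** (1984) 223–250 [Balaban1984PropagatorsII], Sect. C pp. 239–246: the printed
# properties of the Sect. C operators `G` (2.22), `C^{(j)}_Λ` (2.110), `G_j`, `(Q_jG_jQ_j*)⁻¹`, `H_j` (2.130), `G̃_j` (2.131),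
# `Δ_j` (2.118), `C̃^{(j)}_Λ` (p. 246) of `…B6SectCOperators.TwoScaleData` PROVED from the two printed positivity facts

statement-level skeleton of published theorems with citation tags; proofs where landed; nothing here is a claim about the Yang–Mills mass gap

PDF held: `paper:balaban1984-cmp96-propagators-rt-ii` (journal page = PDF page + 222); pp. 224–228, 239–246 read AS IMAGES on
the ×2 renders `run/shared/lean/pub/pub-balaban/b2b-balaban-ref1/pages/1984-cmp96-propagators-rt-II/` (2026-08-21).
CITATION HEADER (lean-in-tree rule).  WHAT IS REPRODUCED: lit-balaban SKELETON rows **B6.Eq2.129 / B6.Eq2.119** (with B6.Eq2.110,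
B6.Eq2.130, B6.Eq2.131, B6.Txt@246): for the operators DEFINED in `…B6SectCOperators` from the primitive two-scale data `D`, every
defining property that the (2.119)/(2.129) files of this seat carry as a HYPOTHESIS (`hG`, `hC`/`hCr`/`hCsol`, `hHj`, `hcrit`,
`hGt`/`hsol`, `h2118`, `hΔj`, `hCt`/`hCtsol`, the non-vanishing normalisations) is PROVED from `D.IsLattice` (the printed lattice
identities) and `D.Positive` = the TWO printed positivity facts: p. 226 *"the operator Δ_a is bounded from below by a positive
constant"* (qualitative Sect. A form) and (2.11) *"the Laplace operator Δ is … invertible on this subspace"*.  KEY STEP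
(`form2112_pos`): **positivity of the (2.112)/(2.120) form on the gauge-fixed configurations is DERIVED from `Δ_a > 0`** through
the gauge transformation `A′ ↦ A′ − ∂H′_jω` with `ω = C^{(j)}_ΛH′_j*Δ∂*A′` ((2.105)–(2.106) read backwards: the cross term is
removed, all three squares of `Δ_a` vanish, (2.96) forces `A′ = 0`) — print asserts this positivity via Lemma 2.4 / (2.120) (p. 244,
p. 246 *"the forms are bounded from below by γ₀″‖B‖²"*); the uniform constant `γ₀″` is Lemma 2.4's business (rows B6.Lem2.4,
B6.Txt@246, r03 `…B6Form2122LowerBound`) and is NOT claimed here.  Consequences: `Δ − ∂P_j∂* > 0` on `{Q_jA = 0}` ([4] (1.72)),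
`G_j`, `(Q_jG_jQ_j*)⁻¹`, `Q_jH_j = I`, `H_j` critical, `G̃_j` a covariance AND equal to the printed (2.131) (`Gt_eq_tildeOp`),
`Q″*aQ″ + Δ_j > 0` on the axial `B`, `C̃^{(j)}_Λ` its covariance, symmetric and positive.  PHASE-2 seat p22 (gen 8); owner r03,
referee ref-4.  IMPORTS, restating nothing: `…B6SectCOperators` (same seat), `…BIJ85Eq461Proof` (p30: `exists_coercive`).
HONEST SCOPE: finite-dimensional model; hypotheses = `IsLattice` + `Positive` (their own rows); NOT summit progress.
Unit `lit-balaban-p22` (gen 8), HOME `run/shared/lean/pub/lit-balaban/`, 2026-08-21.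
-/

noncomputable section

open scoped InnerProductSpace

namespace Literature.MathematicalPhysics.QuantumFieldTheory.Balaban1983to89.B6SectCPositivity

open B6CovarianceOperator B6SectCOperators B6SectCOperators.TwoScaleData

variable {A B W T Bs V : Type*}
  [NormedAddCommGroup A] [InnerProductSpace ℝ A] [FiniteDimensional ℝ A]
  [NormedAddCommGroup B] [InnerProductSpace ℝ B] [FiniteDimensional ℝ B]
  [NormedAddCommGroup W] [InnerProductSpace ℝ W] [FiniteDimensional ℝ W]
  [NormedAddCommGroup T] [InnerProductSpace ℝ T] [FiniteDimensional ℝ T]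
  [NormedAddCommGroup Bs] [InnerProductSpace ℝ Bs] [FiniteDimensional ℝ Bs]
  [NormedAddCommGroup V] [InnerProductSpace ℝ V] [FiniteDimensional ℝ V]
  {D : TwoScaleData A B W T Bs V}

/-! ### `Δ_a > 0` and `G = Δ_a⁻¹` -/

/-- **`Δ_a` is positive definite** (p. 226). [cite: Balaban1984PropagatorsII, (2.19)–(2.22) p.226 + p.228] -/
theorem deltaA_pos (hL : D.IsLattice) (hP : D.Positive) (v : A) (hv : v ≠ 0) : 0 < ⟪v, D.deltaA v⟫_ℝ := by
  rw [form_deltaA hL]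
  have ha : 0 ≤ ⟪D.Qpp (D.Qv v), D.a (D.Qpp (D.Qv v))⟫_ℝ := nonneg_of_posDef D.a hL.a_pos _
  rcases (add_nonneg (add_nonneg (sq_nonneg ‖D.curl v‖) (sq_nonneg ‖D.R (D.dv v)‖)) ha).lt_or_eq with h | h
  · exact h
  · exfalso
    have h1 : ‖D.curl v‖ ^ 2 = 0 := by nlinarith [sq_nonneg ‖D.curl v‖, sq_nonneg ‖D.R (D.dv v)‖]
    have h2 : ‖D.R (D.dv v)‖ ^ 2 = 0 := by nlinarith [sq_nonneg ‖D.curl v‖, sq_nonneg ‖D.R (D.dv v)‖]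
    have h3 : ⟪D.Qpp (D.Qv v), D.a (D.Qpp (D.Qv v))⟫_ℝ = 0 := by nlinarith [sq_nonneg ‖D.curl v‖, sq_nonneg ‖D.R (D.dv v)‖]
    have hc : D.curl v = 0 := norm_eq_zero.mp (pow_eq_zero_iff two_ne_zero |>.mp h1)
    have hR : D.R (D.dv v) = 0 := norm_eq_zero.mp (pow_eq_zero_iff two_ne_zero |>.mp h2)
    have hQ : D.Qpp (D.Qv v) = 0 := by
      by_contra hne
      exact (hL.a_pos _ hne).ne' h3
    exact hv (hP.zeroModes v hc ((R_dv_eq_zero_iff v).mp hR) hQ)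

/-- *"bounded from below by a positive constant"*: `⟨A,Δ_aA⟩ ≥ γ_a‖A‖²` with `γ_a > 0`. [cite: Balaban1984PropagatorsII, p.226] -/
theorem deltaA_coercive (hL : D.IsLattice) (hP : D.Positive) :
    ∃ γ : ℝ, 0 < γ ∧ ∀ v : A, γ * ‖v‖ ^ 2 ≤ ⟪v, D.deltaA v⟫_ℝ :=
  BalabanImbrieJaffe1984to88.BIJ85Eq461Proof.exists_coercive D.deltaA (deltaA_pos hL hP)

/-- **`Δ_aG = I`** (2.22). [cite: Balaban1984PropagatorsII, (2.22) p.226] -/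
theorem deltaA_comp_G (hL : D.IsLattice) (hP : D.Positive) : D.deltaA ∘ₗ D.G = LinearMap.id :=
  comp_inverse D.deltaA (deltaA_pos hL hP)

/-- `GΔ_a = I`. [cite: Balaban1984PropagatorsII, (2.22) p.226] -/
theorem G_comp_deltaA (hL : D.IsLattice) (hP : D.Positive) : D.G ∘ₗ D.deltaA = LinearMap.id :=
  inverse_comp D.deltaA (deltaA_pos hL hP)

/-- `G` is symmetric and positive (*"The operator G is positive"*, p. 228). [cite: Balaban1984PropagatorsII, p.228] -/
theorem G_symm (hL : D.IsLattice) (hP : D.Positive) (x y : A) : ⟪D.G x, y⟫_ℝ = ⟪x, D.G y⟫_ℝ :=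
  inverse_symm D.deltaA (deltaA_symm hL) (deltaA_pos hL hP) x y

/-- Any right inverse of `Δ_a` IS `G`. [cite: Balaban1984PropagatorsII, (2.22) p.226] -/
theorem eq_G_of_rightInverse (hL : D.IsLattice) (hP : D.Positive) (G' : A →ₗ[ℝ] A) (hG' : D.deltaA ∘ₗ G' = LinearMap.id) :
    G' = D.G := by
  refine LinearMap.ext fun v => ?_
  have h1 : D.deltaA (G' v) = v := by simpa using LinearMap.congr_fun hG' v
  have h2 := congrArg D.G h1
  rwa [show D.G (D.deltaA (G' v)) = G' v from inverse_apply D.deltaA (deltaA_pos hL hP) _] at h2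

/-! ### `Δ′_j > 0` on the admissible `ω`, and `C^{(j)}_Λ` -/

/-- `H′_j` is injective with left inverse `Q′_j` (2.101). [cite: Balaban1984PropagatorsII, (2.101) p.241] -/
theorem Qp_hP_apply (hL : D.IsLattice) (w : W) : D.Qp (D.hP w) = w := by
  simpa using LinearMap.congr_fun hL.Qp_hP w

/-- `H′_jω ∈ N(Q′)` for admissible `ω` (*"λ₀ … belongs to N(Q′)"*, (2.105)). [cite: Balaban1984PropagatorsII, (2.105) p.241] -/
theorem hP_mem_NQ (hL : D.IsLattice) (ω : ↥D.S₁) : D.hP (ω : W) ∈ D.NQ := by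
  rw [Submodule.mem_comap, Qp_hP_apply hL]; exact ω.2

/-- `⟨ω, Δ′_jω′⟩ = ⟨ΔH′_jω, ΔH′_jω′⟩` (2.107). [cite: Balaban1984PropagatorsII, (2.107) p.242] -/
theorem inner_Dp (hL : D.IsLattice) (ω ω' : W) : ⟪ω, D.Dp ω'⟫_ℝ = ⟪D.lap (D.hP ω), D.lap (D.hP ω')⟫_ℝ := by
  simp only [Dp, LinearMap.coe_comp, Function.comp_apply]
  rw [LinearMap.adjoint_inner_right, lap_symm hL]

/-- `Δ′_j` is symmetric. [cite: Balaban1984PropagatorsII, (2.107) p.242] -/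
theorem Dp_symm (hL : D.IsLattice) (x y : W) : ⟪D.Dp x, y⟫_ℝ = ⟪x, D.Dp y⟫_ℝ := by
  rw [real_inner_comm, inner_Dp hL, inner_Dp hL, real_inner_comm]

/-- **`Δ′_j > 0` on the admissible `ω`** (the lower bound of (2.110), qualitative form) — from (2.11). [cite: Balaban1984PropagatorsII, (2.110) p.242 + (2.11) p.225] -/
theorem Dp_pos (hL : D.IsLattice) (hP : D.Positive) (ω : ↥D.S₁) (hω : ω ≠ 0) : 0 < ⟪(ω : W), D.Dp ω⟫_ℝ := by
  rw [inner_Dp hL, real_inner_self_eq_norm_sq]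
  have hne : D.lap (D.hP (ω : W)) ≠ 0 := by
    intro h
    have h1 := hP.lapInj ⟨D.hP ω, hP_mem_NQ hL ω⟩ h
    have h2 : D.hP (ω : W) = 0 := congrArg Subtype.val h1
    have h3 : (ω : W) = 0 := by rw [← Qp_hP_apply hL (ω : W), h2, map_zero]
    exact hω (Subtype.ext h3)
  positivity

/-- `C^{(j)}_Λ` ranges in the admissible `ω` (hypothesis `hCr` of `…B6Eq2112`). [cite: Balaban1984PropagatorsII, (2.110) p.242] -/
theorem C_eq (s : W) : D.C s = D.S₁.subtype (D.TC s) := rfl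

/-- `C^{(j)}_Λ` is symmetric (hypothesis `hC`). [cite: Balaban1984PropagatorsII, (2.110) p.242] -/
theorem C_symm (hL : D.IsLattice) (hP : D.Positive) (x y : W) : ⟪D.C x, y⟫_ℝ = ⟪x, D.C y⟫_ℝ :=
  covOp_symm D.S₁ D.Dp (Dp_symm hL) (Dp_pos hL hP) x y

/-- **`C^{(j)}_Λ` is a covariance of `Δ′_j` on the admissible `ω`** (hypothesis `hCsol` of `…B6Eq2112`).
[cite: Balaban1984PropagatorsII, (2.106)–(2.110) p.242] -/
theorem C_sol (hL : D.IsLattice) (hP : D.Positive) (ω : ↥D.S₁) (s : W) :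
    ⟪(ω : W), D.Dp (D.C s)⟫_ℝ = ⟪(ω : W), s⟫_ℝ :=
  covOp_sol D.S₁ D.Dp (Dp_pos hL hP) ω s

/-! ### Positivity of the (2.112)/(2.120) form on the gauge-fixed configurations, from `Δ_a > 0` -/

/-- `N(Q′) ∋ m` decomposes as `(m − H′_jQ′_jm) + H′_jQ′_jm` with the first summand in `N(Q′_j)` (`…B6Eq2106.decompEquiv`).
[cite: Balaban1984PropagatorsII, (2.105) p.241] -/
theorem NQ_decomp (hL : D.IsLattice) (m : ↥D.NQ) :
    ∃ (n : ↥D.Nj) (ω : ↥D.S₁), (m : B) = (n : B) + D.hP (ω : W) := by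
  refine ⟨⟨(m : B) - D.hP (D.Qp m), ?_⟩, ⟨D.Qp m, m.2⟩, ?_⟩
  · rw [LinearMap.mem_ker, map_sub, Qp_hP_apply hL, sub_self]
  · simp

/-- **The gauge transformation removes the cross term**: for a gauge-fixed `A′` with `R_j∂*A′ = 0` and `ω := C^{(j)}_ΛH′_j*Δ∂*A′`,
the configuration `A′ − ∂H′_jω` has `∂*(A′ − ∂H′_jω) ⊥ ΔN(Q′)` — the mechanism of (2.105)–(2.106) read backwards.
[cite: Balaban1984PropagatorsII, (2.105)–(2.106) pp.241–242] -/
theorem R_dv_gauge_eq_zero (hL : D.IsLattice) (hP : D.Positive) (s : A) (hs : D.Rj (D.dv s) = 0) :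
    ∀ m : ↥D.NQ, ⟪D.lap (m : B), D.dv (s - D.grad (D.hP (D.C (LinearMap.adjoint D.hP (D.lap (D.dv s))))))⟫_ℝ = 0 := by
  intro m
  obtain ⟨n, ω', hm⟩ := NQ_decomp hL m
  set x := LinearMap.adjoint D.hP (D.lap (D.dv s)) with hx
  have hRj : ∀ n : ↥D.Nj, ⟪D.lap (n : B), D.dv s⟫_ℝ = 0 := by
    intro n
    rw [Rj_apply, Submodule.starProjection_apply_eq_zero_iff, Submodule.mem_orthogonal] at hs
    exact hs _ (Submodule.mem_map_of_mem n.2)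
  rw [hm, map_add, inner_add_left, map_sub, hL.dv_grad, inner_sub_right, inner_sub_right, hRj n, hL.hP_orth n, sub_zero,
    zero_add, ← inner_Dp hL, C_sol hL hP ω', hx, LinearMap.adjoint_inner_right, lap_symm hL, sub_self]

/-- **The (2.112)/(2.120) form is positive definite on the gauge-fixed configurations** (p. 244 *"It is a Gaussian integral
defined by the quadratic form (2.120)"*, p. 246 *"the forms are bounded from below"*) — here DERIVED from `Δ_a > 0`: if
`⟨Q″Q_jA′,aQ″Q_jA′⟩ + ⟨A′,(Δ−∂P_j∂*)A′⟩ = 0` for a gauge-fixed `A′`, then `A′ − ∂H′_jω` (ω as above) is annihilated by all three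
squares of `Δ_a`, hence vanishes, and (2.96) forces `A′ = 0`. [cite: Balaban1984PropagatorsII, (2.120) p.244 + p.246] -/
theorem form2112_pos (hL : D.IsLattice) (hP : D.Positive) (s : ↥D.Sg) (hs : s ≠ 0) : 0 < D.form2112 (s : A) := by
  have ha : 0 ≤ ⟪D.Qpp (D.Qv (s : A)), D.a (D.Qpp (D.Qv (s : A)))⟫_ℝ := nonneg_of_posDef D.a hL.a_pos _
  have hM := form_Mj_nonneg hL (s : A)
  rcases (add_nonneg ha hM).lt_or_eq with h | h
  · exact h
  · exfalso
    have h1 : ⟪D.Qpp (D.Qv (s : A)), D.a (D.Qpp (D.Qv (s : A)))⟫_ℝ = 0 := by linarith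
    have h2 : ⟪(s : A), D.Mj (s : A)⟫_ℝ = 0 := by linarith
    rw [form_Mj hL] at h2
    have hc : D.curl (s : A) = 0 :=
      norm_eq_zero.mp (pow_eq_zero_iff two_ne_zero |>.mp (by nlinarith [sq_nonneg ‖D.curl (s : A)‖, sq_nonneg ‖D.Rj (D.dv (s : A))‖]))
    have hR : D.Rj (D.dv (s : A)) = 0 :=
      norm_eq_zero.mp (pow_eq_zero_iff two_ne_zero |>.mp (by nlinarith [sq_nonneg ‖D.curl (s : A)‖, sq_nonneg ‖D.Rj (D.dv (s : A))‖]))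
    have hQ : D.Qpp (D.Qv (s : A)) = 0 := by
      by_contra hne
      exact (hL.a_pos _ hne).ne' h1
    -- the gauge transformation A′ ↦ A′ − ∂H′_jω
    set ω : W := D.C (LinearMap.adjoint D.hP (D.lap (D.dv (s : A)))) with hω
    set v : A := (s : A) - D.grad (D.hP ω) with hv
    have hωmem : ω ∈ D.S₁ := covOp_mem D.S₁ D.Dp _
    have hv0 : v = 0 := by
      refine hP.zeroModes v ?_ (R_dv_gauge_eq_zero hL hP (s : A) hR) ?_
      · rw [hv, map_sub, hc, hL.curl_grad, sub_zero]
      · rw [hv, map_sub, map_sub, hQ, hL.Qv_grad, Qp_hP_apply hL, hL.Qpp_d1 ⟨ω, hωmem⟩, sub_zero]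
    -- (2.96): the axial B of A′ is ∂₁ω, so ω = 0 and A′ = 0
    have hs' : (s : A) = D.grad (D.hP ω) := by rw [← sub_eq_zero, ← hv]; exact hv0
    have hax : (0 : Bs) + D.d1 ((⟨ω, hωmem⟩ : ↥D.S₁) : W) ∈ D.Ax := by
      rw [zero_add]
      have h3 : D.Qv (s : A) ∈ D.Ax := s.2
      rwa [hs', hL.Qv_grad, Qp_hP_apply hL] at h3
    have hax0 : (0 : Bs) + D.d1 ((0 : ↥D.S₁) : W) ∈ D.Ax := by simp
    have hω0 : (⟨ω, hωmem⟩ : ↥D.S₁) = 0 := (hL.axial 0).unique hax hax0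
    have hω0' : ω = 0 := congrArg Subtype.val hω0
    have : (s : A) = 0 := by rw [hs', hω0', map_zero, map_zero]
    exact hs (Subtype.ext this)

/-- The (2.112) form as the form of a symmetric operator on the gauge-fixed configurations: coercive with a constant `γ₂ > 0`
(p. 246 *"bounded from below by γ₀″‖B‖²"*, qualitative). [cite: Balaban1984PropagatorsII, p.246] -/
theorem form2112_coercive (hL : D.IsLattice) (hP : D.Positive) :
    ∃ γ : ℝ, 0 < γ ∧ ∀ s : ↥D.Sg, γ * ‖s‖ ^ 2 ≤ D.form2112 (s : A) := by
  set F : A →ₗ[ℝ] A := LinearMap.adjoint D.Q ∘ₗ D.a ∘ₗ D.Q + D.Mj with hF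
  have hFform : ∀ s : ↥D.Sg, ⟪s, compress D.Sg F s⟫_ℝ = D.form2112 (s : A) := by
    intro s
    rw [inner_compress, hF, LinearMap.add_apply, inner_add_right, form2112]
    simp only [LinearMap.coe_comp, Function.comp_apply]
    rw [LinearMap.adjoint_inner_right]
    rfl
  obtain ⟨γ, hγ, h⟩ := BalabanImbrieJaffe1984to88.BIJ85Eq461Proof.exists_coercive (compress D.Sg F)
    (fun s hs => by rw [hFform]; exact form2112_pos hL hP s hs)
  exact ⟨γ, hγ, fun s => by rw [← hFform]; exact h s⟩

/-! ### `M_j > 0` on `{Q_jA = 0}`; `G_j`, `(Q_jG_jQ_j*)⁻¹`, `H_j` (2.130), `G̃_j` (2.131) -/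

/-- **`Δ − ∂P_j∂* > 0` on `{Q_jA = 0}`** ([4] (1.72): the zero-mode step of Sect. D, here a corollary of `form2112_pos` since
`{Q_jA = 0}` is gauge-fixed). [cite: Balaban1984PropagatorsII, (2.114) p.243] -/
theorem Mj_pos_ker (hL : D.IsLattice) (hP : D.Positive) (v : A) (hQ : D.Qv v = 0) (hv : v ≠ 0) : 0 < ⟪v, D.Mj v⟫_ℝ := by
  have hmem : v ∈ D.Sg := by rw [Submodule.mem_comap, hQ]; exact D.Ax.zero_mem
  have h := form2112_pos hL hP ⟨v, hmem⟩ (fun h => hv (congrArg Subtype.val h))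
  simp only [form2112, hQ, map_zero, inner_zero_left, zero_add] at h
  exact h

/-- `M_j + Q_j*Q_j` is positive definite on all vector fields. [cite: Balaban1984PropagatorsII, (2.130) p.246] -/
theorem MjQ_pos (hL : D.IsLattice) (hP : D.Positive) (v : A) (hv : v ≠ 0) :
    0 < ⟪v, (D.Mj + LinearMap.adjoint D.Qv ∘ₗ D.Qv) v⟫_ℝ := by
  have h1 : ⟪v, (D.Mj + LinearMap.adjoint D.Qv ∘ₗ D.Qv) v⟫_ℝ = ⟪v, D.Mj v⟫_ℝ + ‖D.Qv v‖ ^ 2 := by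
    rw [LinearMap.add_apply, inner_add_right, LinearMap.comp_apply, LinearMap.adjoint_inner_right,
      real_inner_self_eq_norm_sq]
  rw [h1]
  by_cases hQ : D.Qv v = 0
  · rw [hQ, norm_zero]; simpa using Mj_pos_ker hL hP v hQ hv
  · have : 0 < ‖D.Qv v‖ ^ 2 := by positivity
    linarith [form_Mj_nonneg hL v]

/-- `M_j + Q_j*Q_j` is symmetric. [cite: Balaban1984PropagatorsII, (2.130) p.246] -/
theorem MjQ_symm (hL : D.IsLattice) (x y : A) :
    ⟪(D.Mj + LinearMap.adjoint D.Qv ∘ₗ D.Qv) x, y⟫_ℝ = ⟪x, (D.Mj + LinearMap.adjoint D.Qv ∘ₗ D.Qv) y⟫_ℝ := by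
  simp only [LinearMap.add_apply, LinearMap.comp_apply, inner_add_left, inner_add_right]
  rw [Mj_symm hL, LinearMap.adjoint_inner_left, LinearMap.adjoint_inner_right]

/-- **`(M_j + Q_j*Q_j)G_j = I`** — `G_j` of [4] (1.69)–(1.71) is a right inverse (hypothesis `hG` of `…B6Eq2130`, `a = 1`).
[cite: Balaban1984PropagatorsII, (2.130) p.246] -/
theorem hGj (hL : D.IsLattice) (hP : D.Positive) :
    (D.Mj + LinearMap.adjoint D.Qv ∘ₗ LinearMap.id ∘ₗ D.Qv) ∘ₗ D.Gj = LinearMap.id :=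
  comp_inverse _ (MjQ_pos hL hP)

/-- `G_j` is symmetric and positive. [cite: Balaban1984PropagatorsII, (2.130) p.246] -/
theorem Gj_pos (hL : D.IsLattice) (hP : D.Positive) (x : A) (hx : x ≠ 0) : 0 < ⟪x, D.Gj x⟫_ℝ :=
  inverse_pos _ (MjQ_pos hL hP) x hx

/-- `Q_j*` is injective (`Q_j` onto). [cite: Balaban1984PropagatorsII, (2.130) p.246] -/
theorem Qv_adjoint_injective (hL : D.IsLattice) : Function.Injective (LinearMap.adjoint D.Qv) := by
  intro x y hxy
  have h : ∀ v, ⟪x - y, D.Qv v⟫_ℝ = 0 := fun v => by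
    rw [← LinearMap.adjoint_inner_left, map_sub, hxy, sub_self, inner_zero_left]
  obtain ⟨v, hv⟩ := hL.Qv_surj (x - y)
  have := h v
  rw [hv, real_inner_self_eq_norm_sq, sq_eq_zero_iff, norm_eq_zero] at this
  exact sub_eq_zero.mp this

/-- *"QGQ* is positive also and an inverse is a well-defined and positive operator"* (p. 228), here for `Q_jG_jQ_j*`.
[cite: Balaban1984PropagatorsII, p.228 + (2.130) p.246] -/
theorem QGQ_pos (hL : D.IsLattice) (hP : D.Positive) (b : Bs) (hb : b ≠ 0) :
    0 < ⟪b, (D.Qv ∘ₗ D.Gj ∘ₗ LinearMap.adjoint D.Qv) b⟫_ℝ := by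
  have hb' : LinearMap.adjoint D.Qv b ≠ 0 := fun h => hb (Qv_adjoint_injective hL (by rw [h, map_zero]))
  simp only [LinearMap.coe_comp, Function.comp_apply]
  rw [← LinearMap.adjoint_inner_left]
  exact Gj_pos hL hP _ hb'

/-- **`(Q_jG_jQ_j*)E_j = I`** (hypothesis `hE` of `…B6Eq2130`). [cite: Balaban1984PropagatorsII, (2.130) p.246] -/
theorem hEj (hL : D.IsLattice) (hP : D.Positive) :
    (D.Qv ∘ₗ D.Gj ∘ₗ LinearMap.adjoint D.Qv) ∘ₗ D.Ej = LinearMap.id :=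
  comp_inverse _ (QGQ_pos hL hP)

/-- The adjoint pairing of `Q_j*`. [cite: Balaban1984PropagatorsII, (2.130) p.246] -/
theorem Qvs_adj (w : Bs) (v : A) : ⟪LinearMap.adjoint D.Qv w, v⟫_ℝ = ⟪w, D.Qv v⟫_ℝ := LinearMap.adjoint_inner_left _ _ _

/-- **`Q_jH_j = I`** for the printed `H_j` (2.130) (hypothesis `hHj`). [cite: Balaban1984PropagatorsII, (2.130) p.246] -/
theorem Qv_Hj (hL : D.IsLattice) (hP : D.Positive) (b : Bs) : D.Qv (D.Hj b) = b :=
  B6Eq2130.Q_hOp D.Gj D.Qv (LinearMap.adjoint D.Qv) D.Ej (hEj hL hP) b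

/-- **`H_jB` is the critical configuration of `½⟨A,(Δ−∂P_j∂*)A⟩` on `{Q_jA = B}`** (hypothesis `hcrit` of
`…B6GaussianIdentity2119.eq2119`), for the printed `H_j` (2.130). [cite: Balaban1984PropagatorsII, (2.130) p.246] -/
theorem Hj_crit (hL : D.IsLattice) (hP : D.Positive) (b : Bs) (v : A) (hv : D.Qv v = 0) : ⟪v, D.Mj (D.Hj b)⟫_ℝ = 0 :=
  B6Eq2130.hOp_crit D.Mj D.Gj D.Qv (LinearMap.adjoint D.Qv) LinearMap.id D.Ej (Qvs_adj) (hGj hL hP) (hEj hL hP) b v hv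

/-- `H_jB` is gauge-fixed (`Q_jH_jB = B` axial for axial `B`). [cite: Balaban1984PropagatorsII, (2.112) p.243 + (2.130) p.246] -/
theorem Hj_mem_Sg (hL : D.IsLattice) (hP : D.Positive) (m : ↥D.Ax) : D.Hj (m : Bs) ∈ D.Sg := by
  rw [Submodule.mem_comap, Qv_Hj hL hP]; exact m.2

/-- `G̃_j` ranges in `{Q_jA = 0}` (hypotheses `hGt`/`hιA`). [cite: Balaban1984PropagatorsII, (2.115) p.243 + (2.131) p.246] -/
theorem Gt_eq (J : A) : D.Gt J = D.NA.subtype (D.Tt J) := rfl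

/-- **`G̃_j` is a covariance of the Gaussian (2.114)** (hypothesis `hsol`): `⟨v,(Δ−∂P_j∂*)G̃_jJ⟩ = ⟨v,J⟩` for `Q_jv = 0`.
[cite: Balaban1984PropagatorsII, (2.115) p.243] -/
theorem Gt_sol (hL : D.IsLattice) (hP : D.Positive) (n : ↥D.NA) (J : A) : ⟪(n : A), D.Mj (D.Gt J)⟫_ℝ = ⟪(n : A), J⟫_ℝ :=
  covOp_sol D.NA D.Mj (fun k hk => Mj_pos_ker hL hP k k.2 (fun h => hk (Subtype.ext h))) n J

/-- **`G̃_j = G_j − G_jQ_j*(Q_jG_jQ_j*)⁻¹Q_jG_j` (2.131) AS PRINTED**: the covariance of (2.114) IS the printed operator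
(`…B6SectA.tildeOp`), by uniqueness of the covariance (`…B6Eq2130.tildeOp_sol`, `Q_tildeOp`). [cite: Balaban1984PropagatorsII, (2.131) p.246] -/
theorem Gt_eq_tildeOp (hL : D.IsLattice) (hP : D.Positive) :
    D.Gt = B6SectA.tildeOp D.Gj D.Qv (LinearMap.adjoint D.Qv) D.Ej := by
  refine cov_unique D.NA D.Mj (fun k hk => Mj_pos_ker hL hP k k.2 (fun h => hk (Subtype.ext h))) _ _
    (covOp_mem D.NA D.Mj) (fun J => ?_) (fun n J => Gt_sol hL hP n J) (fun n J => ?_)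
  · exact B6Eq2130.Q_tildeOp D.Gj D.Qv (LinearMap.adjoint D.Qv) D.Ej (hEj hL hP) J
  · exact B6Eq2130.tildeOp_sol D.Mj D.Gj D.Qv (LinearMap.adjoint D.Qv) LinearMap.id D.Ej (Qvs_adj) (hGj hL hP) n J n.2

/-! ### `Δ_j`, `Q″*aQ″ + Δ_j > 0` on the axial `B`, and `C̃^{(j)}_Λ` -/

/-- The adjoint pairing of `H_j*` (hypothesis `hadj`). [cite: Balaban1984PropagatorsII, (2.119) p.243] -/
theorem Hjs_adj (b : Bs) (x : A) : ⟪D.Hj b, x⟫_ℝ = ⟪b, LinearMap.adjoint D.Hj x⟫_ℝ := (LinearMap.adjoint_inner_right _ _ _).symm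

/-- **`⟨H_jB,(Δ−∂P_j∂*)H_jB⟩ = ⟨B,Δ_jB⟩`** (hypothesis `h2118`; for THIS `Δ_j` an identity — its equality with the δ-gauge form
(1.66) of [4] is `…B6Eq2129FaddeevPopov.forms_eq_of_pos`). [cite: Balaban1984PropagatorsII, (2.116)–(2.118) p.243] -/
theorem h2118 (b : Bs) : ⟪D.Hj b, D.Mj (D.Hj b)⟫_ℝ = ⟪b, D.Δj b⟫_ℝ := by
  simp only [Δj, LinearMap.coe_comp, Function.comp_apply]
  rw [LinearMap.adjoint_inner_right]

/-- `Δ_j` is symmetric (hypothesis `hΔj`). [cite: Balaban1984PropagatorsII, (2.118) p.243] -/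
theorem Δj_symm (hL : D.IsLattice) (x y : Bs) : ⟪D.Δj x, y⟫_ℝ = ⟪x, D.Δj y⟫_ℝ := by
  simp only [Δj, LinearMap.coe_comp, Function.comp_apply]
  rw [LinearMap.adjoint_inner_left, LinearMap.adjoint_inner_right, Mj_symm hL]

/-- The adjoint pairing of `Q″*` (hypothesis `hQpp`). [cite: Balaban1984PropagatorsII, (2.119) p.243] -/
theorem Qpps_adj (w : V) (b : Bs) : ⟪LinearMap.adjoint D.Qpp w, b⟫_ℝ = ⟪w, D.Qpp b⟫_ℝ := LinearMap.adjoint_inner_left _ _ _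

/-- `⟨B, (Q″*aQ″ + Δ_j)B⟩` is the (2.112) form at `H_jB` (the form (2.120)). [cite: Balaban1984PropagatorsII, (2.119)–(2.120) pp.243–244] -/
theorem inner_Sb (hL : D.IsLattice) (hP : D.Positive) (b : Bs) : ⟪b, D.Sb b⟫_ℝ = D.form2112 (D.Hj b) := by
  rw [Sb, LinearMap.add_apply, inner_add_right, ← h2118, form2112, Qv_Hj hL hP]
  simp only [LinearMap.coe_comp, Function.comp_apply]
  rw [LinearMap.adjoint_inner_right]

/-- `Q″*aQ″ + Δ_j` is symmetric. [cite: Balaban1984PropagatorsII, (2.120) p.244] -/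
theorem Sb_symm (hL : D.IsLattice) (x y : Bs) : ⟪D.Sb x, y⟫_ℝ = ⟪x, D.Sb y⟫_ℝ := by
  simp only [Sb, LinearMap.add_apply, LinearMap.coe_comp, Function.comp_apply, inner_add_left, inner_add_right]
  rw [LinearMap.adjoint_inner_left, LinearMap.adjoint_inner_right, hL.a_symm, Δj_symm hL]

/-- **`Q″*aQ″ + Δ_j > 0` on the axial `B`** (p. 246 *"the forms are bounded from below by γ₀″‖B‖²"*, qualitative form, from
`Δ_a > 0`). [cite: Balaban1984PropagatorsII, p.246] -/
theorem Sb_pos (hL : D.IsLattice) (hP : D.Positive) (m : ↥D.Ax) (hm : m ≠ 0) : 0 < ⟪(m : Bs), D.Sb m⟫_ℝ := by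
  rw [inner_Sb hL hP]
  refine form2112_pos hL hP ⟨D.Hj m, Hj_mem_Sg hL hP m⟩ fun h => hm ?_
  have h1 : D.Hj (m : Bs) = 0 := congrArg Subtype.val h
  have h2 : (m : Bs) = 0 := by rw [← Qv_Hj hL hP (m : Bs), h1, map_zero]
  exact Subtype.ext h2

/-- `C̃^{(j)}_Λ` ranges in the axial `B` (hypothesis `hCt`). [cite: Balaban1984PropagatorsII, (2.129) p.246] -/
theorem Ct_eq (K' : Bs) : D.Ct K' = D.Ax.subtype (D.TB K') := rfl

/-- **`C̃^{(j)}_Λ` is a covariance of the `B`-Gaussian of (2.119)** (hypothesis `hCtsol` of `…B6Repr2129.eq2129`).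
[cite: Balaban1984PropagatorsII, (2.119) p.243 + (2.129) p.246] -/
theorem Ct_sol (hL : D.IsLattice) (hP : D.Positive) (m : ↥D.Ax) (K' : Bs) :
    ⟪(m : Bs), (LinearMap.adjoint D.Qpp ∘ₗ D.a ∘ₗ D.Qpp + D.Δj) (D.Ct K')⟫_ℝ = ⟪(m : Bs), K'⟫_ℝ :=
  covOp_sol D.Ax D.Sb (Sb_pos hL hP) m K'

/-- *"the operators C̃^{(j)}_Λ are bounded from above by γ₀″⁻¹I"* in the qualitative form: `C̃^{(j)}_Λ` is symmetric and positive
on the axial `B`. [cite: Balaban1984PropagatorsII, p.246] -/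
theorem Ct_symm_pos (hL : D.IsLattice) (hP : D.Positive) :
    (∀ x y : Bs, ⟪D.Ct x, y⟫_ℝ = ⟪x, D.Ct y⟫_ℝ) ∧ ∀ m : ↥D.Ax, m ≠ 0 → 0 < ⟪(m : Bs), D.Ct m⟫_ℝ :=
  ⟨covOp_symm D.Ax D.Sb (Sb_symm hL) (Sb_pos hL hP), covOp_pos D.Ax D.Sb (Sb_pos hL hP)⟩

end Literature.MathematicalPhysics.QuantumFieldTheory.Balaban1983to89.B6SectCPositivity

end
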